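import Summits.BirchSwinnertonDyer.BirchSwinnertonDyer.Theorems.ThetaPartnerAtTwoSignedKatoUpToAtTwoCyclotomicPadicEmbedding
import HarnessLib

/-!
# Route `ThetaPartnerAtTwo` (TP2), crux K3 `SignedKatoDivisibilityUpToAtTwo` (stmt-BirchSwinnertonDyer-20308 / K3P′ 25631), line
# `colemanrat` v13 — brick B2 READ `p`-ADICALLY: Kato's value law × Birch at an even primitive character as an identity in `ℚ̄_p`
# (Galois-orbit character sum of `e(x_{k,∅})` against the `p`-adic Gauss sum), and the descent of `ℚ̄_p`-valued characters to `ℚ(ζ_{p^k})`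

Width seat `bsd-wall-tp2-p2x-w4` g0 (cell `bsd-wall`); item (D3) of the 12:03Z offer for the lead's socket `coreChiPrim_of_coreKBK` (memo
`Cruxes/SignedKatoDivisibilityUpToAtTwo/G7-ASSEMBLY-v1.md` §0 steps 3–5). HONEST FRAMING: theorems only (no definition, no named fact, no instance,
no `sorry`); CONDITIONAL on a `ZetaBody` witness (the conclusion of the cite-only fact `Kato2004.exists_eulerSystem_expStar_values`); closes no
item; K3 / K3P′ are NOT settled and BSD is NOT proved by any of this.

## What (`m = cycLevel p k ∅` (`= p^k`), `F = CyclotomicField m ℚ`, `e : F →+* PadicAlgCl p` with `e(ζ_F) = zeta p k`, `τ_a ∈ Γ_{ℚ_p}` with `τ_a ζ_{p^k} = ζ_{p^k}^a`)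

* §1 `exists_ringHomComp_eq_of_pow_eq_one`: a `ℚ̄_p`-valued Dirichlet character `ψ₂` modulo `m` all of whose values are `m`-th roots of unity is
  `ψ.ringHomComp e` for a (unique) `F`-valued `ψ`; at `p = 2` the hypothesis is automatic (`exists_ringHomComp_eq_two`: `φ(2^k) ∣ 2^k`).
* §2 **`charSum_smul_mul_gaussSum_eq_padic`**: from `ZetaBody W p f ι κ Λ c d a A z x`, `κ = q`, `A = p^e`, `1 ≤ k`, guards, `ι_m(ζ_F) = e^{2πi/m}`,
  and an `F`-valued even primitive `ψ`:
  `(Σ_{b∈(ℤ/m)ˣ} ψ_e⁻¹(b) · τ_b • e(x_{k,∅})) · τ_{ℚ̄_p}(ψ_e) = q · ratTwistedSymbolSum f ψ_e · R⁻(ψ_e)` in `ℚ̄_p`, `ψ_e = ψ.ringHomComp e`,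
  `τ_{ℚ̄_p}(ψ_e) = Σ_a ψ_e(a) ζ_{p^k}^a`, `R⁻(ψ_e) = c²d²[a/A]⁻ − cd²ψ_e(c)[ac/A]⁻ − c²dψ_e(d)[ad′/A]⁻ + cdψ_e(cd)[acd′/A]⁻` — B2
  (`KatoValue.charSumF_mul_gaussSum_eq`) pushed along `e` with `map_charSumF_eq_sum_smul` / `map_gaussSum_eq` / `ratTwistedSymbolSum_ringHomComp`.
  The first factor is the right-hand factor of the lead's `KatoBK.sum_pow_mul_trace_eq_mul`.

References: [Kato2004Asterisque] Thm. 6.6 (1) (p. 163), Thm. 9.7 (p. 189), (5.7.1) (p. 157); [MazurTateTeitelbaum1986Invent] §I.8 (8.6);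
[Kobayashi2003] Prop. 8.25 (p. 24).
-/

set_option autoImplicit false
-- the Theorems namespace of this sub repeats the summit name by design (D-0017 nested layout)
set_option linter.dupNamespace false
-- `IsCyclotomicExtension {m} ℚ (CyclotomicField m ℚ)` through `NeZero ((m : ℕ) : ℚ)` (as in `EulerSystemValues.sigma`)
set_option backward.isDefEq.respectTransparency false

noncomputable section

open scoped BigOperators NumberField TensorProduct MatrixGroups Real

open CongruenceSubgroup Complex WeierstrassCurve IsDedekindDomain Polynomial
  Literature.NumberTheory.GaloisRepresentations
  Literature.NumberTheory.EllipticCurves Literature.NumberTheory.EllipticCurves.ModularForms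
  Literature.NumberTheory.EllipticCurves.Kato2004 Literature.NumberTheory.EllipticCurves.Kato2004.EulerSystemValues
  Summit.BirchSwinnertonDyer.Rank1Residual.Additive

namespace Summit.BirchSwinnertonDyer.BirchSwinnertonDyer.Theorems.SignedKatoOffTwo.KatoValue

/-! ## §1 Descent of `ℚ̄_p`-valued characters to `ℚ(ζ_{p^k})`-valued ones along `e` -/

section DescentF

variable {p : ℕ} [Fact p.Prime] {k : ℕ} {m : ℕ} [NeZero m]

/-- **Descent `ℚ̄_p → ℚ(ζ_{p^k})` along `e`**: if `e(ζ_F) = ζ_{p^k}` with `ζ_{p^k}^m = 1` and every value of `ψ₂ : DirichletCharacter ℚ̄_p m` on a unit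
is an `m`-th root of unity, then `ψ₂ = ψ.ringHomComp e` for some `F`-valued `ψ` (the `m`-th roots of unity of `ℚ̄_p` are the `e(ζ_F^j)`;
multiplicativity of the preimages by injectivity of `e`). [folklore] -/
theorem exists_ringHomComp_eq_of_pow_eq_one (e : CyclotomicField m ℚ →+* PadicAlgCl p)
    (he : e (IsCyclotomicExtension.zeta m ℚ (CyclotomicField m ℚ)) = PadicCyclotomicTower.zeta p k)
    (hz : IsPrimitiveRoot (PadicCyclotomicTower.zeta p k) m)
    (ψ₂ : DirichletCharacter (PadicAlgCl p) m) (hord : ∀ u : (ZMod m)ˣ, ψ₂ (u : ZMod m) ^ m = 1) :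
    ∃ ψ : DirichletCharacter (CyclotomicField m ℚ) m, ψ.ringHomComp e = ψ₂ := by
  classical
  have hinj : Function.Injective e := e.injective
  have hex : ∀ u : (ZMod m)ˣ, ∃ y : CyclotomicField m ℚ, e y = ψ₂ (u : ZMod m) := by
    intro u
    obtain ⟨i, -, hi⟩ := hz.eq_pow_of_pow_eq_one (hord u)
    exact ⟨IsCyclotomicExtension.zeta m ℚ (CyclotomicField m ℚ) ^ i, by rw [map_pow, he, hi]⟩
  choose g hg using hex
  have hg1 : g 1 = 1 := hinj (by rw [hg, Units.val_one, map_one, map_one])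
  have hgmul : ∀ u v : (ZMod m)ˣ, g (u * v) = g u * g v := fun u v ↦
    hinj (by rw [hg, map_mul, Units.val_mul, map_mul, hg, hg])
  have hg0 : ∀ u : (ZMod m)ˣ, g u ≠ 0 := by
    intro u h0
    have h := hg u
    rw [h0, map_zero] at h
    have hne : ψ₂ (u : ZMod m) ≠ 0 := by
      rw [← MulChar.coe_toUnitHom]; exact (ψ₂.toUnitHom u).ne_zero
    exact hne h.symm
  let f : (ZMod m)ˣ →* (CyclotomicField m ℚ)ˣ :=
    { toFun := fun u ↦ Units.mk0 (g u) (hg0 u)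
      map_one' := Units.ext (by simp [hg1])
      map_mul' := fun u v ↦ Units.ext (by simp [hgmul]) }
  refine ⟨MulChar.ofUnitHom f, MulChar.ext fun u ↦ ?_⟩
  rw [MulChar.ringHomComp_apply, MulChar.ofUnitHom_eq, MulChar.equivToUnitHom_symm_coe]
  exact hg u

/-- **At `p = 2` the descent is unconditional**: for `m = 2^k` every value of a Dirichlet character modulo `m` on a unit is an `m`-th root
of unity (`φ(2^k) = 2^{k−1} ∣ 2^k`), so every `ℚ̄₂`-valued character modulo `m` is `ψ.ringHomComp e`. [folklore] -/
theorem exists_ringHomComp_eq_two (hm : m = 2 ^ k) (e : CyclotomicField m ℚ →+* PadicAlgCl 2)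
    (he : e (IsCyclotomicExtension.zeta m ℚ (CyclotomicField m ℚ)) = PadicCyclotomicTower.zeta 2 k)
    (ψ₂ : DirichletCharacter (PadicAlgCl 2) m) :
    ∃ ψ : DirichletCharacter (CyclotomicField m ℚ) m, ψ.ringHomComp e = ψ₂ := by
  have hz : IsPrimitiveRoot (PadicCyclotomicTower.zeta 2 k) m := by
    rw [hm]; exact PadicCyclotomicTower.isPrimitiveRoot_zeta 2 k
  refine exists_ringHomComp_eq_of_pow_eq_one e he hz ψ₂ fun u ↦ ?_
  have hcard : ψ₂ (u : ZMod m) ^ Fintype.card (ZMod m)ˣ = 1 := by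
    rw [← MulChar.coe_toUnitHom, ← Units.val_pow_eq_pow_val, ← map_pow, pow_card_eq_one, map_one, Units.val_one]
  have hdvd : Fintype.card (ZMod m)ˣ ∣ m := by
    rw [ZMod.card_units_eq_totient, hm]
    rcases Nat.eq_zero_or_pos k with rfl | hk
    · simp
    · rw [Nat.totient_prime_pow Nat.prime_two hk]
      exact ⟨2, by rw [show (2 - 1 : ℕ) = 1 from rfl, mul_one, ← pow_succ, Nat.sub_add_cancel hk]⟩
  obtain ⟨t, ht⟩ := hdvd
  have key : ψ₂ (u : ZMod m) ^ m = (ψ₂ (u : ZMod m) ^ Fintype.card (ZMod m)ˣ) ^ t := by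
    rw [← pow_mul, ← ht]
  rw [key, hcard, one_pow]

end DescentF

/-! ## §2 B2 along `e`: the `p`-adic value law at an even primitive character -/

section Main

variable {W : WeierstrassCurve ℚ} [W.IsElliptic] {N : ℕ} [NeZero N] {f : CuspForm (Gamma0 N) 2}

/-- **Kato's value law × Birch, read in `ℚ̄_p`.** In the setting of `KatoValue.charSumF_mul_gaussSum_eq` (newform `f` of `W`, prime `p`,
`ZetaBody W p f ι κ Λ c d a A z x`, `κ = q ∈ ℚ`, `A = p^e`, `k ≥ 1`, `(cd, m·A) = 1`, `dd′ ≡ 1 (A)`, `ι_m(ζ_F) = e^{2πi/m}`, `m = cycLevel p k ∅`),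
for `e : F →+* ℚ̄_p` with `e(ζ_F) = ζ_{p^k}` (`zeta p k`, so `ζ_{p^k}^m = 1`), a family `τ_a ∈ Γ_{ℚ_p}` with `τ_a ζ_{p^k} = ζ_{p^k}^a` on units, and an
`F`-valued EVEN PRIMITIVE `ψ` modulo `m`, with `ψ_e := ψ.ringHomComp e`:
`(Σ_{b ∈ (ℤ/m)ˣ} ψ_e⁻¹(b) · τ_b • e(x_{k,∅})) · Σ_a ψ_e(a) ζ_{p^k}^a = q · ratTwistedSymbolSum f ψ_e · R⁻(ψ_e)` in `ℚ̄_p`.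
CONDITIONAL on the `ZetaBody` witness. [cite: Kato2004Asterisque, Thm. 6.6 (1) (p. 163), Thm. 9.7 (p. 189), (5.7.1) (p. 157)]
[cite: MazurTateTeitelbaum1986Invent, §I.8 (8.6)] -/
theorem charSum_smul_mul_gaussSum_eq_padic (hf : IsNewformOf W f) (p : ℕ) [Fact p.Prime]
    [ContinuousSMul ℤ_[p] (W.tateModule p)] [Module.Free ℤ_[p] (W.tateModule p)] [Module.Finite ℤ_[p] (W.tateModule p)]
    {ι : (m : ℕ) → (CyclotomicField m ℚ →+* ℂ)} {κ : ℝ}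
    {Λ : ∀ (k : ℕ) (r : Finset (HeightOneSpectrum (𝓞 ℚ))),
      H1 (tateRep W p) (cycSubgroup p k r) →ₗ[ℤ_[p]] ℚ_[p] ⊗[ℚ] CyclotomicField (cycLevel p k r) ℚ}
    {c d a : ℤ} {A : ℕ}
    {z : ∀ (k : ℕ) (r : (cyclotomicLevelsRat p (badPlaces c d A N)).Ideals),
      H1 (tateRep W p) ((cyclotomicLevelsRat p (badPlaces c d A N)).level k r.1)}
    {x : ∀ (k : ℕ) (r : (cyclotomicLevelsRat p (badPlaces c d A N)).Ideals),
      CyclotomicField (cycLevel p k r.1) ℚ}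
    (hbody : ZetaBody W p f ι κ Λ c d a A z x) {q : ℚ} (hκ : κ = q)
    {k e : ℕ} (hk : 1 ≤ k) (hA : A = p ^ e) (d' : ℤ)
    (hcd : Int.gcd (c * d) (cycLevel p k (∅ : Finset (HeightOneSpectrum (𝓞 ℚ))) * A) = 1)
    (hdd' : d * d' ≡ 1 [ZMOD (A : ℤ)])
    (hι : ι (cycLevel p k (∅ : Finset (HeightOneSpectrum (𝓞 ℚ))))
        (IsCyclotomicExtension.zeta (cycLevel p k (∅ : Finset (HeightOneSpectrum (𝓞 ℚ)))) ℚ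
          (CyclotomicField (cycLevel p k (∅ : Finset (HeightOneSpectrum (𝓞 ℚ)))) ℚ)) =
      Complex.exp (2 * π * I / (cycLevel p k (∅ : Finset (HeightOneSpectrum (𝓞 ℚ))) : ℕ)))
    (eP : CyclotomicField (cycLevel p k (∅ : Finset (HeightOneSpectrum (𝓞 ℚ)))) ℚ →+* PadicAlgCl p)
    (heP : eP (IsCyclotomicExtension.zeta (cycLevel p k (∅ : Finset (HeightOneSpectrum (𝓞 ℚ)))) ℚ
          (CyclotomicField (cycLevel p k (∅ : Finset (HeightOneSpectrum (𝓞 ℚ)))) ℚ)) = PadicCyclotomicTower.zeta p k)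
    (hz : PadicCyclotomicTower.zeta p k ^ cycLevel p k (∅ : Finset (HeightOneSpectrum (𝓞 ℚ))) = 1)
    (τ : ZMod (cycLevel p k (∅ : Finset (HeightOneSpectrum (𝓞 ℚ)))) → Field.absoluteGaloisGroup ℚ_[p])
    (hτ : ∀ b : ZMod (cycLevel p k (∅ : Finset (HeightOneSpectrum (𝓞 ℚ)))), IsUnit b →
      τ b • PadicCyclotomicTower.zeta p k = PadicCyclotomicTower.zeta p k ^ b.val)
    (ψ : DirichletCharacter (CyclotomicField (cycLevel p k (∅ : Finset (HeightOneSpectrum (𝓞 ℚ)))) ℚ)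
      (cycLevel p k (∅ : Finset (HeightOneSpectrum (𝓞 ℚ)))))
    (hψ : ψ.IsPrimitive) (hev : ψ.Even) :
    (∑ b : (ZMod (cycLevel p k (∅ : Finset (HeightOneSpectrum (𝓞 ℚ)))))ˣ,
        (ψ.ringHomComp eP)⁻¹ (b : ZMod _) * τ (b : ZMod _) • eP (x k (cyclotomicLevelsRat p (badPlaces c d A N)).idealOne)) *
      gaussSum (ψ.ringHomComp eP) (AddChar.zmodChar (cycLevel p k (∅ : Finset (HeightOneSpectrum (𝓞 ℚ)))) hz) =
    algebraMap ℚ (PadicAlgCl p) q * ratTwistedSymbolSum f (ψ.ringHomComp eP) *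
      (((c : PadicAlgCl p) ^ 2 * (d : PadicAlgCl p) ^ 2) * ((ratMinusSymbol f ((a : ℚ) / A) : ℚ) : PadicAlgCl p) -
          ((c : PadicAlgCl p) * (d : PadicAlgCl p) ^ 2) * (ψ.ringHomComp eP) ((c : ℤ) : ZMod _) *
            ((ratMinusSymbol f ((a * c : ℚ) / A) : ℚ) : PadicAlgCl p) -
          ((c : PadicAlgCl p) ^ 2 * (d : PadicAlgCl p)) * (ψ.ringHomComp eP) ((d : ℤ) : ZMod _) *
            ((ratMinusSymbol f ((a * d' : ℚ) / A) : ℚ) : PadicAlgCl p) +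
          ((c : PadicAlgCl p) * (d : PadicAlgCl p)) * (ψ.ringHomComp eP) ((c * d : ℤ) : ZMod _) *
            ((ratMinusSymbol f ((a * c * d' : ℚ) / A) : ℚ) : PadicAlgCl p)) := by
  have hB2 := charSumF_mul_gaussSum_eq hf p hbody hκ hk hA d' hcd hdd' hι ψ hψ hev
  have h := congrArg eP hB2
  rw [map_mul, map_charSumF_eq_sum_smul eP heP τ hτ ψ, map_gaussSum_eq eP heP hz ψ, map_mul, map_mul, map_ratCast,
    ← ratTwistedSymbolSum_ringHomComp eP f ψ] at h
  rw [h, eq_ratCast]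
  congr 1
  simp only [map_add, map_sub, map_mul, map_pow, map_intCast, map_ratCast, MulChar.ringHomComp_apply]

end Main

end Summit.BirchSwinnertonDyer.BirchSwinnertonDyer.Theorems.SignedKatoOffTwo.KatoValue

end
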